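import Summits.CriticalPhenomena.PercolationContinuityZ3.Theorems.PercNearOneGluingNoHeavyLowerTailFourPointFaceDefs
import Mathlib.Data.Real.Basic
import Mathlib.Tactic.Ring
import Mathlib.Tactic.Linarith
import Mathlib.Tactic.Positivity
import HarnessLib

/-!
# `NoHeavyLowerTail` (stmt-CriticalPhenomena-4575) — (L1) face-first, part 4: the `b`-GLUING channel of the first-order variation is nonpositive

Support file (prover prim-l12-p6, line P6; `--supports stmt-CriticalPhenomena-4575`).  Pure algebra, no sorries, no definitions.

CONTEXT (seat report P6-REPORT §2).  At a face point `x⁰ = μ ⊗ (r₀,r₁)` (`b` separates `{a,y}` from `c`; `μ = (μQ,μAB,μAY,μBY,μT)` the law of `(a,b,y)`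
on the near side) and a far block `G₂` glued at `b` and at a near vertex `v`, the first-order variation of (L1) along a crossing edge decomposes over
the states of `G₂` as `U^{cw}·Π_cv − H_b(G₂)·Π_bv/r₁`, where `Π_bv = ∇polL₁(x⁰)·(μ′ ⊗ c|)` is the contribution of the channel "`b` gets glued to
`v` while `c` stays off the near side", `μ′` = the law of `(a,b,y)` after gluing `v` into `b`.  Gluing only moves mass UP: `μ′ = μ + δ(τ)` with the
six transition masses `τ = (αa, αy, αay, β₁, β₂, β₃) ≥ 0` (`a|b|y → ab|y, a|by, aby`; `ab|y → aby`; `ay|b → aby`; `a|by → aby`).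
THIS FILE: the polarisation identity `polL₁(x⁰ + μ′⊗c|) − polL₁(x⁰ − μ′⊗c|) = 2·∇polL₁(x⁰)·(μ′⊗c|)` (the cubic term `polL₁(μ′⊗c|)` vanishes:
`c` isolated) evaluates to `−2·[(αa+αay+β₂)·P_A + αy·P_Y + β₃·P_3]` with `P_A, P_Y, P_3` polynomials with POSITIVE coefficients in `(μ, r₀, r₁)` — so
`Π_bv ≤ 0` coefficientwise (`faceGrad_glueB_nonpos`): the `b`-gluing channel never decreases (L1) (it enters with the sign `−H_b ≤ 0`).  Together with
`…FourPointFaceFirstOrder` (the `c`-attachment channel, Harris-positive) and `H_b ≥ r₁U^{cw}` (Aas–Gladkov on `G₂`) this gives first-order positivity of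
(L1) off the cut-vertex face for EVERY far block (the assembly over the states of `G₂` is linear bookkeeping, recorded in the report, not here).
[cite: GladkovZimin2024HK, §4 (one-coordinate decomposition; the forms and the analysis are this programme's)]
-/

namespace Summit.CriticalPhenomena.PercolationContinuityZ3.Theorems

namespace CubicFourPoint

variable {R : Type*} [CommRing R]

set_option maxRecDepth 10000 in
set_option maxHeartbeats 1600000 in
/-- **The `b`-gluing channel**: `polL₁(x⁰ + μ′⊗c|) − polL₁(x⁰ − μ′⊗c|) = −2·[(αa+αay+β₂)·P_A(μ,r) + αy·P_Y(μ,r) + β₃·P_3(μ,r)]` with `P_A`, `P_Y`, `P_3` explicit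
positive-coefficient polynomials (`x⁰ = μ⊗(r₀,r₁)` the face point, `μ′ = μ + δ(τ)` the glued near-side law placed in the `c`-isolated cells). [this work] -/
theorem polL₁_faceGrad_glueB (μQ μAB μAY μBY μT r₀ r₁ αa αy αay β₁ β₂ β₃ : R) :
    polL₁ (μQ * r₀ + (μQ - αa - αy - αay)) 0 (μBY * r₀ + (μBY + αy - β₃)) (μQ * r₁) (μAY * r₀ + (μAY - β₂)) 0 (μAB * r₀ + (μAB + αa - β₁)) (μBY * r₁) (μAY * r₁) 0 0 0 (μT * r₀ + (μT + αay + β₁ + β₂ + β₃)) (μAB * r₁) (μT * r₁)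
      - polL₁ (μQ * r₀ - (μQ - αa - αy - αay)) 0 (μBY * r₀ - (μBY + αy - β₃)) (μQ * r₁) (μAY * r₀ - (μAY - β₂)) 0 (μAB * r₀ - (μAB + αa - β₁)) (μBY * r₁) (μAY * r₁) 0 0 0 (μT * r₀ - (μT + αay + β₁ + β₂ + β₃)) (μAB * r₁) (μT * r₁)
      = -2 * ((αa + αay + β₂) * (4 * μT * μAB * r₀ * r₁ + 8 * μT * μAB * r₁ ^ 2 + 4 * μT * μAY * r₀ * r₁ + 6 * μT * μAY * r₁ ^ 2 + 4 * μT * μBY * r₀ * r₁ + 7 * μT * μBY * r₁ ^ 2 + 4 * μT * μQ * r₀ * r₁ + 6 * μT * μQ * r₁ ^ 2 + 2 * μT ^ 2 * r₀ * r₁ + 4 * μT ^ 2 * r₁ ^ 2 + 4 * μAB * μAY * r₀ * r₁ + 6 * μAB * μAY * r₁ ^ 2 + 4 * μAB * μBY * r₀ * r₁ + 7 * μAB * μBY * r₁ ^ 2 + 4 * μAB * μQ * r₀ * r₁ + 6 * μAB * μQ * r₁ ^ 2 + 2 * μAB ^ 2 * r₀ * r₁ + 4 * μAB ^ 2 * r₁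 ^ 2 + 4 * μAY * μBY * r₀ * r₁ + 5 * μAY * μBY * r₁ ^ 2 + 4 * μAY * μQ * r₀ * r₁ + 4 * μAY * μQ * r₁ ^ 2 + 2 * μAY ^ 2 * r₀ * r₁ + 2 * μAY ^ 2 * r₁ ^ 2 + 4 * μBY * μQ * r₀ * r₁ + 5 * μBY * μQ * r₁ ^ 2 + 2 * μBY ^ 2 * r₀ * r₁ + 3 * μBY ^ 2 * r₁ ^ 2 + 2 * μQ ^ 2 * r₀ * r₁ + 2 * μQ ^ 2 * r₁ ^ 2)
          + αy * (2 * μT * μAB * r₀ * r₁ + 4 * μT * μAB * r₁ ^ 2 + 2 * μT * μAY * r₀ * r₁ + 3 * μT * μAY * r₁ ^ 2 + 2 * μT * μBY * r₀ * r₁ + 3 * μT * μBY * r₁ ^ 2 + 2 * μT * μQ * r₀ * r₁ + 3 * μT * μQ * r₁ ^ 2 + μT ^ 2 * r₀ * r₁ + 2 * μT ^ 2 * r₁ ^ 2 + 2 * μAB * μAY * r₀ * r₁ + 3 * μAB * μAY * r₁ ^ 2 + 2 * μAB * μBY * r₀ * r₁ + 3 * μAB * μBY * r₁ ^ 2 +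 2 * μAB * μQ * r₀ * r₁ + 3 * μAB * μQ * r₁ ^ 2 + μAB ^ 2 * r₀ * r₁ + 2 * μAB ^ 2 * r₁ ^ 2 + 2 * μAY * μBY * r₀ * r₁ + 2 * μAY * μBY * r₁ ^ 2 + 2 * μAY * μQ * r₀ * r₁ + 2 * μAY * μQ * r₁ ^ 2 + μAY ^ 2 * r₀ * r₁ + μAY ^ 2 * r₁ ^ 2 + 2 * μBY * μQ * r₀ * r₁ + 2 * μBY * μQ * r₁ ^ 2 + μBY ^ 2 * r₀ * r₁ + μBY ^ 2 * r₁ ^ 2 + μQ ^ 2 * r₀ * r₁ + μQ ^ 2 * r₁ ^ 2)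
          + β₃ * (2 * μT * μAB * r₀ * r₁ + 4 * μT * μAB * r₁ ^ 2 + 2 * μT * μAY * r₀ * r₁ + 3 * μT * μAY * r₁ ^ 2 + 2 * μT * μBY * r₀ * r₁ + 4 * μT * μBY * r₁ ^ 2 + 2 * μT * μQ * r₀ * r₁ + 3 * μT * μQ * r₁ ^ 2 + μT ^ 2 * r₀ * r₁ + 2 * μT ^ 2 * r₁ ^ 2 + 2 * μAB * μAY * r₀ * r₁ + 3 * μAB * μAY * r₁ ^ 2 + 2 * μAB * μBY * r₀ * r₁ + 4 * μAB * μBY * r₁ ^ 2 + 2 * μAB * μQ * r₀ * r₁ + 3 * μAB * μQ * r₁ ^ 2 + μAB ^ 2 * r₀ * r₁ + 2 * μAB ^ 2 * r₁ ^ 2 + 2 * μAY * μBY * r₀ * r₁ + 3 * μAY * μBY * r₁ ^ 2 + 2 * μAY * μQ * r₀ * r₁ + 2 * μAY * μQ * r₁ ^ 2 + μAY ^ 2 * r₀ * r₁ + μAY ^ 2 * r₁ ^ 2 + 2 * μBY * μQ * r₀ * r₁ + 3 * μBY * μQ * r₁ ^ 2 + μBY ^ 2 * r₀ * r₁ + 2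 * μBY ^ 2 * r₁ ^ 2 + μQ ^ 2 * r₀ * r₁ + μQ ^ 2 * r₁ ^ 2)) := by
  simp only [polL₁, hybE₁, hybE₂, E3h]
  ring

set_option maxHeartbeats 800000 in
/-- **`Π_bv ≤ 0`**: for a nonnegative near-side law `μ`, nonnegative `r₀, r₁` and nonnegative gluing transitions `τ`, the `b`-gluing channel of the
first-order variation of (L1) at the face is `≤ 0`. [this work] -/
theorem faceGrad_glueB_nonpos {μQ μAB μAY μBY μT r₀ r₁ αa αy αay β₁ β₂ β₃ : ℝ}
    (hQ : 0 ≤ μQ) (hAB : 0 ≤ μAB) (hAY : 0 ≤ μAY) (hBY : 0 ≤ μBY) (hT : 0 ≤ μT) (hr₀ : 0 ≤ r₀) (hr₁ : 0 ≤ r₁)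
    (ha : 0 ≤ αa) (hy : 0 ≤ αy) (hay : 0 ≤ αay) (h₂ : 0 ≤ β₂) (h₃ : 0 ≤ β₃) :
    polL₁ (μQ * r₀ + (μQ - αa - αy - αay)) 0 (μBY * r₀ + (μBY + αy - β₃)) (μQ * r₁) (μAY * r₀ + (μAY - β₂)) 0 (μAB * r₀ + (μAB + αa - β₁)) (μBY * r₁) (μAY * r₁) 0 0 0 (μT * r₀ + (μT + αay + β₁ + β₂ + β₃)) (μAB * r₁) (μT * r₁)
      - polL₁ (μQ * r₀ - (μQ - αa - αy - αay)) 0 (μBY * r₀ - (μBY + αy - β₃)) (μQ * r₁) (μAY * r₀ - (μAY - β₂)) 0 (μAB * r₀ - (μAB + αa - β₁)) (μBY * r₁) (μAY * r₁) 0 0 0 (μT * r₀ - (μT + αay + β₁ + β₂ + β₃)) (μAB * r₁) (μT * r₁) ≤ 0 := by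
  rw [polL₁_faceGrad_glueB]
  have hA : 0 ≤ 4 * μT * μAB * r₀ * r₁ + 8 * μT * μAB * r₁ ^ 2 + 4 * μT * μAY * r₀ * r₁ + 6 * μT * μAY * r₁ ^ 2 + 4 * μT * μBY * r₀ * r₁ + 7 * μT * μBY * r₁ ^ 2 + 4 * μT * μQ * r₀ * r₁ + 6 * μT * μQ * r₁ ^ 2 + 2 * μT ^ 2 * r₀ * r₁ + 4 * μT ^ 2 * r₁ ^ 2 + 4 * μAB * μAY * r₀ * r₁ + 6 * μAB * μAY * r₁ ^ 2 + 4 * μAB * μBY * r₀ * r₁ + 7 * μAB * μBY * r₁ ^ 2 + 4 * μAB * μQ * r₀ * r₁ + 6 * μAB * μQ * r₁ ^ 2 + 2 * μAB ^ 2 * r₀ * r₁ + 4 * μAB ^ 2 * r₁ ^ 2 + 4 * μAY * μBY * r₀ * r₁ + 5 * μAY * μBY * r₁ ^ 2 + 4 * μAY * μQ * r₀ * r₁ + 4 * μAY * μQ * r₁ ^ 2 + 2 * μAY ^ 2 * r₀ * r₁ + 2 * μAY ^ 2 * r₁ ^ 2 + 4 * μBY * μQ * r₀ * r₁ + 5 *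 μBY * μQ * r₁ ^ 2 + 2 * μBY ^ 2 * r₀ * r₁ + 3 * μBY ^ 2 * r₁ ^ 2 + 2 * μQ ^ 2 * r₀ * r₁ + 2 * μQ ^ 2 * r₁ ^ 2 := by positivity
  have hY : 0 ≤ 2 * μT * μAB * r₀ * r₁ + 4 * μT * μAB * r₁ ^ 2 + 2 * μT * μAY * r₀ * r₁ + 3 * μT * μAY * r₁ ^ 2 + 2 * μT * μBY * r₀ * r₁ + 3 * μT * μBY * r₁ ^ 2 + 2 * μT * μQ * r₀ * r₁ + 3 * μT * μQ * r₁ ^ 2 + μT ^ 2 * r₀ * r₁ + 2 * μT ^ 2 * r₁ ^ 2 + 2 * μAB * μAY * r₀ * r₁ + 3 * μAB * μAY * r₁ ^ 2 + 2 * μAB * μBY * r₀ * r₁ + 3 * μAB * μBY * r₁ ^ 2 + 2 * μAB * μQ * r₀ * r₁ + 3 * μAB * μQ * r₁ ^ 2 + μAB ^ 2 * r₀ * r₁ + 2 * μAB ^ 2 * r₁ ^ 2 + 2 * μAY * μBY * r₀ * r₁ + 2 * μAY * μBY * r₁ ^ 2 + 2 * μAY * μQ * r₀ * r₁ + 2 *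 μAY * μQ * r₁ ^ 2 + μAY ^ 2 * r₀ * r₁ + μAY ^ 2 * r₁ ^ 2 + 2 * μBY * μQ * r₀ * r₁ + 2 * μBY * μQ * r₁ ^ 2 + μBY ^ 2 * r₀ * r₁ + μBY ^ 2 * r₁ ^ 2 + μQ ^ 2 * r₀ * r₁ + μQ ^ 2 * r₁ ^ 2 := by positivity
  have h3' : 0 ≤ 2 * μT * μAB * r₀ * r₁ + 4 * μT * μAB * r₁ ^ 2 + 2 * μT * μAY * r₀ * r₁ + 3 * μT * μAY * r₁ ^ 2 + 2 * μT * μBY * r₀ * r₁ + 4 * μT * μBY * r₁ ^ 2 + 2 * μT * μQ * r₀ * r₁ + 3 * μT * μQ * r₁ ^ 2 + μT ^ 2 * r₀ * r₁ + 2 * μT ^ 2 * r₁ ^ 2 + 2 * μAB * μAY * r₀ * r₁ + 3 * μAB * μAY * r₁ ^ 2 + 2 * μAB * μBY * r₀ * r₁ + 4 * μAB * μBY * r₁ ^ 2 + 2 * μAB * μQ * r₀ * r₁ + 3 * μAB * μQ * r₁ ^ 2 + μAB ^ 2 * r₀ * r₁ + 2 * μAB ^ 2 * r₁ ^ 2 +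 2 * μAY * μBY * r₀ * r₁ + 3 * μAY * μBY * r₁ ^ 2 + 2 * μAY * μQ * r₀ * r₁ + 2 * μAY * μQ * r₁ ^ 2 + μAY ^ 2 * r₀ * r₁ + μAY ^ 2 * r₁ ^ 2 + 2 * μBY * μQ * r₀ * r₁ + 3 * μBY * μQ * r₁ ^ 2 + μBY ^ 2 * r₀ * r₁ + 2 * μBY ^ 2 * r₁ ^ 2 + μQ ^ 2 * r₀ * r₁ + μQ ^ 2 * r₁ ^ 2 := by positivity
  have hS : 0 ≤ (αa + αay + β₂) * (4 * μT * μAB * r₀ * r₁ + 8 * μT * μAB * r₁ ^ 2 + 4 * μT * μAY * r₀ * r₁ + 6 * μT * μAY * r₁ ^ 2 + 4 * μT * μBY * r₀ * r₁ + 7 * μT * μBY * r₁ ^ 2 + 4 * μT * μQ * r₀ * r₁ + 6 * μT * μQ * r₁ ^ 2 + 2 * μT ^ 2 * r₀ * r₁ + 4 * μT ^ 2 * r₁ ^ 2 + 4 * μAB * μAY * r₀ * r₁ + 6 * μAB * μAY * r₁ ^ 2 + 4 * μAB * μBY * r₀ * r₁ + 7 * μAB * μBY * r₁ ^ 2 +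 4 * μAB * μQ * r₀ * r₁ + 6 * μAB * μQ * r₁ ^ 2 + 2 * μAB ^ 2 * r₀ * r₁ + 4 * μAB ^ 2 * r₁ ^ 2 + 4 * μAY * μBY * r₀ * r₁ + 5 * μAY * μBY * r₁ ^ 2 + 4 * μAY * μQ * r₀ * r₁ + 4 * μAY * μQ * r₁ ^ 2 + 2 * μAY ^ 2 * r₀ * r₁ + 2 * μAY ^ 2 * r₁ ^ 2 + 4 * μBY * μQ * r₀ * r₁ + 5 * μBY * μQ * r₁ ^ 2 + 2 * μBY ^ 2 * r₀ * r₁ + 3 * μBY ^ 2 * r₁ ^ 2 + 2 * μQ ^ 2 * r₀ * r₁ + 2 * μQ ^ 2 * r₁ ^ 2)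
          + αy * (2 * μT * μAB * r₀ * r₁ + 4 * μT * μAB * r₁ ^ 2 + 2 * μT * μAY * r₀ * r₁ + 3 * μT * μAY * r₁ ^ 2 + 2 * μT * μBY * r₀ * r₁ + 3 * μT * μBY * r₁ ^ 2 + 2 * μT * μQ * r₀ * r₁ + 3 * μT * μQ * r₁ ^ 2 + μT ^ 2 * r₀ * r₁ + 2 * μT ^ 2 * r₁ ^ 2 + 2 * μAB * μAY * r₀ * r₁ + 3 * μAB * μAY * r₁ ^ 2 + 2 * μAB * μBY * r₀ * r₁ + 3 * μAB * μBY * r₁ ^ 2 + 2 * μAB * μQ * r₀ * r₁ + 3 * μAB * μQ * r₁ ^ 2 + μAB ^ 2 * r₀ * r₁ + 2 * μAB ^ 2 * r₁ ^ 2 + 2 * μAY * μBY * r₀ * r₁ + 2 * μAY * μBY * r₁ ^ 2 + 2 * μAY * μQ * r₀ * r₁ + 2 * μAY * μQ * r₁ ^ 2 + μAY ^ 2 * r₀ * r₁ + μAY ^ 2 * r₁ ^ 2 + 2 * μBY * μQ * r₀ * r₁ + 2 * μBY * μQ * r₁ ^ 2 + μBY ^ 2 * r₀ * r₁ + μBY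 ^ 2 * r₁ ^ 2 + μQ ^ 2 * r₀ * r₁ + μQ ^ 2 * r₁ ^ 2)
          + β₃ * (2 * μT * μAB * r₀ * r₁ + 4 * μT * μAB * r₁ ^ 2 + 2 * μT * μAY * r₀ * r₁ + 3 * μT * μAY * r₁ ^ 2 + 2 * μT * μBY * r₀ * r₁ + 4 * μT * μBY * r₁ ^ 2 + 2 * μT * μQ * r₀ * r₁ + 3 * μT * μQ * r₁ ^ 2 + μT ^ 2 * r₀ * r₁ + 2 * μT ^ 2 * r₁ ^ 2 + 2 * μAB * μAY * r₀ * r₁ + 3 * μAB * μAY * r₁ ^ 2 + 2 * μAB * μBY * r₀ * r₁ + 4 * μAB * μBY * r₁ ^ 2 + 2 * μAB * μQ * r₀ * r₁ + 3 * μAB * μQ * r₁ ^ 2 + μAB ^ 2 * r₀ * r₁ + 2 * μAB ^ 2 * r₁ ^ 2 + 2 * μAY * μBY * r₀ * r₁ + 3 * μAY * μBY * r₁ ^ 2 + 2 * μAY * μQ * r₀ * r₁ + 2 * μAY * μQ * r₁ ^ 2 + μAY ^ 2 * r₀ * r₁ + μAY ^ 2 * r₁ ^ 2 + 2 * μBY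 * μQ * r₀ * r₁ + 3 * μBY * μQ * r₁ ^ 2 + μBY ^ 2 * r₀ * r₁ + 2 * μBY ^ 2 * r₁ ^ 2 + μQ ^ 2 * r₀ * r₁ + μQ ^ 2 * r₁ ^ 2) :=
    add_nonneg (add_nonneg (mul_nonneg (add_nonneg (add_nonneg ha hay) h₂) hA) (mul_nonneg hy hY)) (mul_nonneg h₃ h3')
  linarith

end CubicFourPoint

end Summit.CriticalPhenomena.PercolationContinuityZ3.Theorems
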